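import Summits.QuantumFields.BalabanUV.Beta.D1BFx.GramWeightJetsMixed

/-!
# `BalabanUV.Beta.D1BFx.GramWeightJetsStatic` — road «BF-x» for binder row D1, slot (K), X₃(ii) ROUTE T, brick K-TA4G (shape (R2)), COROLLARY
# FOR A BACKGROUND-INDEPENDENT GAUGE BASIS (owner ruling ρ-g6-12 (1): on the literal of record `W(B) ≡ W₀ = (1 − Π̂)τᵀ`, `W₁ = W₂ = 0`):
# the Ward hypotheses become the KINEMATIC letters `K_i·W₀ = 0`, `K_iᵀ·W₀ = 0`, `Q_i·W₀ = 0`, the comb-Gram term drops out, and the FP Gram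
# jets are `W₀ᵀ B_i W₀` — all background dependence of the Faddeev–Popov factor sits in the WEIGHT jets `B_i = gram_i τ′ A`

HONEST DEPENDENCY (cell records, verbatim): «continuum YM on T⁴ ⇐ BetaPertH ∧ nine spine estimates (0/9 proved); BetaPertH ⇐ (D1) ∧ (D4) ∧
CAP+tail; G-an2-4 gates asym, D1 and NE2/3/4.»  HONEST FRAMING (cell contract, verbatim): «discharging `BetaPertH` makes Bałaban's UV stability
UNCONDITIONAL — a real constructive-QFT result; it is NOT the continuum limit and NOT the Clay problem.»  THIS MODULE DISCHARGES NOTHING of (K),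
of D1 or of the wall: [folklore] specialisation of PART 2c `GramWeightJetsMixed.mixedVar_gramTransfer_jets` ∕ `hessT_gramTransfer_jets` at zero
gauge-basis jets, BY NAME.  No definition, no `def … : Prop`, nothing cited, no wall binder instantiated, 0 sorry.  NOT D1, NOT BetaPertH, NOT
continuum, NOT Clay.

ABSOLUTE RULE (cell charter, verbatim): «No internally-minted statement may enter as a cited fact. Every hypothesis is either kernel-proved in this
package or a verbatim quotation of a PUBLISHED theorem with page reference. The manuscript(s) under audit are NOT citable for their own disputed
steps — they are the thing under adjudication; programme-internal (2001/route/tribunal) claims are never citable.»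
Provenance: G-an2-4 formalisation swarm leaf seat `b2b-balaban-gan24-formalise-leaf-03` gen 44 (cross-lane), K-TA4G corollary for ρ-g6-12, 2026-08-20.
-/

noncomputable section

namespace Summit.QuantumFields.BalabanUV.Beta.D1BFx.GramWeightJetsStatic

open Matrix
open Literature.MathematicalPhysics.QuantumFieldTheory.Balaban1983to89.Beta.Composition (kkt)
open Summit.QuantumFields.BalabanUV.Beta.D1BFx.SliceTransferJetsMixed (mixedVar)
open Summit.QuantumFields.BalabanUV.Beta.D1BFx.MixedVarPackedHess (hessT mixedVar_kkt_fromRows_zero mixedVar_eq_two_mul_hessT)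
open Summit.QuantumFields.BalabanUV.Beta.D1BFx.GramWeightJets (gram₀ gram₁ gram₂)
open Summit.QuantumFields.BalabanUV.Beta.D1BFx.GramWeightJetsMixed (gramMix mixedVar_gramTransfer_jets)

section Static

variable {ι κ : Type*} [Fintype ι]

/-- [folklore] With a static basis the first Gram jet is the sandwich of the weight jet: `gram₁ W₀ 0 B₀ B₁ = W₀ᵀB₁W₀`. -/
theorem gram₁_static (W₀ : Matrix ι κ ℝ) (B₀ B₁ : Matrix ι ι ℝ) : gram₁ W₀ 0 B₀ B₁ = W₀ᵀ * B₁ * W₀ := by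
  simp [gram₁]

/-- [folklore] With a static basis the mixed Gram jet is the sandwich of the mixed weight jet: `gramMix W₀ 0 0 0 B₀ Bₛ Bₜ Bₛₜ = W₀ᵀBₛₜW₀`. -/
theorem gramMix_static (W₀ : Matrix ι κ ℝ) (B₀ Bₛ Bₜ Bₛₜ : Matrix ι ι ℝ) : gramMix W₀ 0 0 0 B₀ Bₛ Bₜ Bₛₜ = W₀ᵀ * Bₛₜ * W₀ := by
  simp [gramMix]

end Static

section Main

variable {ν μ ρ : Type*} [Fintype ν] [Fintype μ] [Fintype ρ] [DecidableEq ν] [DecidableEq μ] [DecidableEq ρ]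

omit [Fintype ν] [Fintype μ] [DecidableEq ν] [DecidableEq μ] in
/-- [folklore] The comb-Gram functional of a static basis vanishes: `mixedVar (τW₀) 0 0 0 = 0`. -/
theorem mixedVar_static (G₀ : Matrix ρ ρ ℝ) : mixedVar G₀ 0 0 0 = 0 := by
  simp [mixedVar]

/-- [folklore] **K-TA4G (R2) FOR A BACKGROUND-INDEPENDENT GAUGE BASIS** (ρ-g6-12 (1)): gauge-basis jets `0`; hypotheses = the KINEMATIC letters
`K_i·W₀ = 0`, `K_iᵀ·W₀ = 0` (`i = 0, s, t, ss, tt, st`), `Q_i·W₀ = 0`, and `det(τW₀)`, `det(τ′₀W₀)`, `det A₀`, `det M ≠ 0`; co-frame and `A`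
jets free (weight jets `B_i = gram_i τ′ A`, `Bₛₜ = gramMix τ′ A`).  Conclusion:
`mixedVar M (kkt-jets) + mixedVar (W₀ᵀB₀W₀) (W₀ᵀBₛW₀) (W₀ᵀBₜW₀) (W₀ᵀBₛₜW₀) = mixedVar N (N-jets)` — no comb-Gram term. -/
theorem mixedVar_gramTransfer_jets_static (K₀ Kₛ Kₜ Kₛₛ Kₜₜ Kₛₜ : Matrix ν ν ℝ) (Q₀ Qₛ Qₜ Qₛₛ Qₜₜ Qₛₜ : Matrix μ ν ℝ)
    (T₀ Tₛ Tₜ Tₛₛ Tₜₜ Tₛₜ : Matrix ρ ν ℝ) (A₀ Aₛ Aₜ Aₛₛ Aₜₜ Aₛₜ : Matrix ρ ρ ℝ) (W₀ : Matrix ν ρ ℝ) (τ : Matrix ρ ν ℝ)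
    (a0 : K₀ * W₀ = 0) (a0t : K₀ᵀ * W₀ = 0) (aₛ : Kₛ * W₀ = 0) (aₛt : Kₛᵀ * W₀ = 0) (aₜ : Kₜ * W₀ = 0) (aₜt : Kₜᵀ * W₀ = 0)
    (aₛₛ : Kₛₛ * W₀ = 0) (aₛₛt : Kₛₛᵀ * W₀ = 0) (aₜₜ : Kₜₜ * W₀ = 0) (aₜₜt : Kₜₜᵀ * W₀ = 0) (aₛₜ : Kₛₜ * W₀ = 0) (aₛₜt : Kₛₜᵀ * W₀ = 0)
    (b0 : Q₀ * W₀ = 0) (bₛ : Qₛ * W₀ = 0) (bₜ : Qₜ * W₀ = 0) (bₛₛ : Qₛₛ * W₀ = 0) (bₜₜ : Qₜₜ * W₀ = 0) (bₛₜ : Qₛₜ * W₀ = 0)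
    (hτ : (τ * W₀).det ≠ 0) (hT : (T₀ * W₀).det ≠ 0) (hA : A₀.det ≠ 0) (hM : (kkt K₀ (fromRows Q₀ τ)).det ≠ 0) :
    mixedVar (kkt K₀ (fromRows Q₀ τ)) (kkt Kₛ (fromRows Qₛ (0 : Matrix ρ ν ℝ))) (kkt Kₜ (fromRows Qₜ (0 : Matrix ρ ν ℝ)))
        (kkt Kₛₜ (fromRows Qₛₜ (0 : Matrix ρ ν ℝ)))
      + mixedVar (W₀ᵀ * gram₀ T₀ A₀ * W₀) (W₀ᵀ * gram₁ T₀ Tₛ A₀ Aₛ * W₀) (W₀ᵀ * gram₁ T₀ Tₜ A₀ Aₜ * W₀)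
          (W₀ᵀ * gramMix T₀ Tₛ Tₜ Tₛₜ A₀ Aₛ Aₜ Aₛₜ * W₀)
    = mixedVar (kkt (K₀ + gram₀ T₀ A₀) Q₀) (kkt (Kₛ + gram₁ T₀ Tₛ A₀ Aₛ) Qₛ) (kkt (Kₜ + gram₁ T₀ Tₜ A₀ Aₜ) Qₜ)
        (kkt (Kₛₜ + gramMix T₀ Tₛ Tₜ Tₛₜ A₀ Aₛ Aₜ Aₛₜ) Qₛₜ) := by
  have h := mixedVar_gramTransfer_jets K₀ Kₛ Kₜ Kₛₛ Kₜₜ Kₛₜ Q₀ Qₛ Qₜ Qₛₛ Qₜₜ Qₛₜ T₀ Tₛ Tₜ Tₛₛ Tₜₜ Tₛₜ A₀ Aₛ Aₜ Aₛₛ Aₜₜ Aₛₜ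
    W₀ 0 0 0 0 0 τ a0 a0t (by simpa using aₛ) (by simpa using aₛt) (by simpa using aₜ) (by simpa using aₜt)
    (by simpa using aₛₛ) (by simpa using aₛₛt) (by simpa using aₜₜ) (by simpa using aₜₜt) (by simpa using aₛₜ) (by simpa using aₛₜt)
    b0 (by simpa using bₛ) (by simpa using bₜ) (by simpa using bₛₛ) (by simpa using bₜₜ) (by simpa using bₛₜ) hτ hT hA hM
  rw [show gram₀ W₀ (gram₀ T₀ A₀) = W₀ᵀ * gram₀ T₀ A₀ * W₀ from rfl, gram₁_static, gram₁_static, gramMix_static] at h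
  simp only [Matrix.mul_zero, mixedVar_static, mul_zero, add_zero] at h
  exact h

/-- [folklore] The same in `hessT` currency (the v2.0 display without the comb-Gram term). -/
theorem hessT_gramTransfer_jets_static (K₀ Kₛ Kₜ Kₛₛ Kₜₜ Kₛₜ : Matrix ν ν ℝ) (Q₀ Qₛ Qₜ Qₛₛ Qₜₜ Qₛₜ : Matrix μ ν ℝ)
    (T₀ Tₛ Tₜ Tₛₛ Tₜₜ Tₛₜ : Matrix ρ ν ℝ) (A₀ Aₛ Aₜ Aₛₛ Aₜₜ Aₛₜ : Matrix ρ ρ ℝ) (W₀ : Matrix ν ρ ℝ) (τ : Matrix ρ ν ℝ)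
    (a0 : K₀ * W₀ = 0) (a0t : K₀ᵀ * W₀ = 0) (aₛ : Kₛ * W₀ = 0) (aₛt : Kₛᵀ * W₀ = 0) (aₜ : Kₜ * W₀ = 0) (aₜt : Kₜᵀ * W₀ = 0)
    (aₛₛ : Kₛₛ * W₀ = 0) (aₛₛt : Kₛₛᵀ * W₀ = 0) (aₜₜ : Kₜₜ * W₀ = 0) (aₜₜt : Kₜₜᵀ * W₀ = 0) (aₛₜ : Kₛₜ * W₀ = 0) (aₛₜt : Kₛₜᵀ * W₀ = 0)
    (b0 : Q₀ * W₀ = 0) (bₛ : Qₛ * W₀ = 0) (bₜ : Qₜ * W₀ = 0) (bₛₛ : Qₛₛ * W₀ = 0) (bₜₜ : Qₜₜ * W₀ = 0) (bₛₜ : Qₛₜ * W₀ = 0)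
    (hτ : (τ * W₀).det ≠ 0) (hT : (T₀ * W₀).det ≠ 0) (hA : A₀.det ≠ 0) (hM : (kkt K₀ (fromRows Q₀ τ)).det ≠ 0) :
    hessT ((kkt K₀ (fromRows Q₀ τ))⁻¹.submatrix (Sum.map id Sum.inl) (Sum.map id Sum.inl)) (kkt Kₛ Qₛ) (kkt Kₜ Qₜ) (kkt Kₛₜ Qₛₜ)
      + hessT (W₀ᵀ * gram₀ T₀ A₀ * W₀)⁻¹ (W₀ᵀ * gram₁ T₀ Tₛ A₀ Aₛ * W₀) (W₀ᵀ * gram₁ T₀ Tₜ A₀ Aₜ * W₀)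
          (W₀ᵀ * gramMix T₀ Tₛ Tₜ Tₛₜ A₀ Aₛ Aₜ Aₛₜ * W₀)
    = hessT (kkt (K₀ + gram₀ T₀ A₀) Q₀)⁻¹ (kkt (Kₛ + gram₁ T₀ Tₛ A₀ Aₛ) Qₛ) (kkt (Kₜ + gram₁ T₀ Tₜ A₀ Aₜ) Qₜ)
        (kkt (Kₛₜ + gramMix T₀ Tₛ Tₜ Tₛₜ A₀ Aₛ Aₜ Aₛₜ) Qₛₜ) := by
  have h := mixedVar_gramTransfer_jets_static K₀ Kₛ Kₜ Kₛₛ Kₜₜ Kₛₜ Q₀ Qₛ Qₜ Qₛₛ Qₜₜ Qₛₜ T₀ Tₛ Tₜ Tₛₛ Tₜₜ Tₛₜ A₀ Aₛ Aₜ Aₛₛ Aₜₜ Aₛₜ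
    W₀ τ a0 a0t aₛ aₛt aₜ aₜt aₛₛ aₛₛt aₜₜ aₜₜt aₛₜ aₛₜt b0 bₛ bₜ bₛₛ bₜₜ bₛₜ hτ hT hA hM
  rw [mixedVar_kkt_fromRows_zero, mixedVar_eq_two_mul_hessT (W₀ᵀ * gram₀ T₀ A₀ * W₀), mixedVar_eq_two_mul_hessT (kkt (K₀ + gram₀ T₀ A₀) Q₀)] at h
  linarith

end Main

/-! ## §3 ε-PARITY OF THE FIRST-ORDER PAIR (v1.1; for TB5-2's sign dictionary, cf. d1-formalise-leaf-03-g9's INFO «TB4-W-SIGN», journal l.24110)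

The colour-stripped FIRST-order sign is a convention `ε = ±1` (every first jet flips with `ε`, zeroth ∕ second jets are `ε`-free).  Kernel facts:
`gram₁` is ODD, `gram₂` ∕ `gramMix` are EVEN, `kkt` is linear, and `hessT` ∕ `mixedVar` are EVEN in their first-jet pair — so every term of
`hessT_gramTransfer_jets(_static)` is invariant under the SIMULTANEOUS flip of all first-order jets, and only a MIXED choice (M-side tables at one `ε`,
weight jets at the other) can change a number.  [folklore] sign bookkeeping; asserts nothing about which `ε` the road's tables carry. -/

section Parity

variable {ι κ : Type*} [Fintype ι]

/-- [folklore] **`gram₁` IS ODD in the first-order pair**: `gram₁ W₀ (−W₁) B₀ (−B₁) = −gram₁ W₀ W₁ B₀ B₁`. -/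
theorem gram₁_neg (W₀ W₁ : Matrix ι κ ℝ) (B₀ B₁ : Matrix ι ι ℝ) : gram₁ W₀ (-W₁) B₀ (-B₁) = -gram₁ W₀ W₁ B₀ B₁ := by
  simp only [gram₁, Matrix.transpose_neg, Matrix.neg_mul, Matrix.mul_neg, neg_add_rev, Matrix.add_mul]
  abel

/-- [folklore] **`gram₂` IS EVEN in the first-order pair**: `gram₂ W₀ (−W₁) W₂ B₀ (−B₁) B₂ = gram₂ W₀ W₁ W₂ B₀ B₁ B₂`. -/
theorem gram₂_neg (W₀ W₁ W₂ : Matrix ι κ ℝ) (B₀ B₁ B₂ : Matrix ι ι ℝ) : gram₂ W₀ (-W₁) W₂ B₀ (-B₁) B₂ = gram₂ W₀ W₁ W₂ B₀ B₁ B₂ := by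
  simp only [gram₂, Matrix.transpose_neg, Matrix.neg_mul, Matrix.mul_neg, neg_add_rev, neg_neg, Matrix.add_mul]
  abel

/-- [folklore] **`gramMix` IS EVEN in the first-order pairs**: flipping `Wₛ Wₜ Bₛ Bₜ` together leaves it unchanged. -/
theorem gramMix_neg (W₀ Wₛ Wₜ Wₛₜ : Matrix ι κ ℝ) (B₀ Bₛ Bₜ Bₛₜ : Matrix ι ι ℝ) :
    gramMix W₀ (-Wₛ) (-Wₜ) Wₛₜ B₀ (-Bₛ) (-Bₜ) Bₛₜ = gramMix W₀ Wₛ Wₜ Wₛₜ B₀ Bₛ Bₜ Bₛₜ := by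
  simp only [gramMix, Matrix.transpose_neg, Matrix.neg_mul, Matrix.mul_neg, neg_neg]

end Parity

section ParityPacked

variable {ν μ : Type*}

/-- [folklore] **`kkt` IS LINEAR**: `kkt (−K) (−Q) = −kkt K Q` (additivity is `BorderedJets.kkt_add`). -/
theorem kkt_neg (K : Matrix ν ν ℝ) (Q : Matrix μ ν ℝ) : kkt (-K) (-Q) = -kkt K Q := by
  rw [kkt, kkt, Matrix.fromBlocks_neg, Matrix.transpose_neg, neg_zero]

variable {ι : Type*} [Fintype ι]

/-- [folklore] **`hessT` IS EVEN in its first-jet pair**: `hessT L (−V) (−V′) W = hessT L V V′ W`. -/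
theorem hessT_neg_neg (L V V' W : Matrix ι ι ℝ) : hessT L (-V) (-V') W = hessT L V V' W := by
  simp only [hessT, Matrix.mul_neg, Matrix.neg_mul, neg_neg]

variable [DecidableEq ι]

/-- [folklore] **`mixedVar` IS EVEN in its first-jet pair**: `mixedVar G (−J) (−J′) W = mixedVar G J J′ W`. -/
theorem mixedVar_neg_neg (G J J' W : Matrix ι ι ℝ) : mixedVar G (-J) (-J') W = mixedVar G J J' W := by
  simp only [mixedVar, Matrix.mul_neg, Matrix.neg_mul, neg_neg]

end ParityPacked

end Summit.QuantumFields.BalabanUV.Beta.D1BFx.GramWeightJetsStatic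

end
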